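import Summits.ABC.IUTFork.Repair.RHLinearReachLawMixed
import Summits.ABC.IUTFork.Repair.RHLinearReachLawDoor
import Summits.ABC.IUTFork.Repair.RHMultiReachFree
import Summits.ABC.IUTFork.Repair.RH2SigmaHull
import HarnessLib

/-!
# D-0079 RESCUE sub-cell R-H, row 20 `linear-reach-law` AT EVERY PRIME — `RHLinearReachLawMixedDoor` (2/2, PROOF-ONLY):
# `CellReachMixAt` on the bad-last summands ⟹ `qRegion (i+1) p ⊆ ⁿ˒°𝒰_{i+1,p}` with NO unique-place hypothesis; `HStarReachMix` ⟹ the hSHw body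

PROOF-ONLY composition file (D-0012: 0 definitions, 0 `Prop` facts; abc-iut cell, rung LADDER-ABC:A2.RESCUE.H; seat abc-iut-rh-typ-7 gen 4, round-2 support
hand of the row-20 lineage; consumer abc-iut-rh2-q2-hull «S|Σ ⟹ abc», rows 15 ⊋ 8, 16, 18, + 20). TAKES NO SIDE on [IUTchIII] Cor. 3.12 or on any author;
the cells (`RHLinearReachLawMixed`, 1/2) are HYPOTHESES, never asserted; typed ≠ proved; instantiated ≠ endorsed; nothing asserts abc.

WHAT IS PROVED (namespace `Summit.ABC.IUTFork.Repair.RH.LinearReachLaw`), for Θ- and q-ideles HONESTLY REALISING the pilot divisors (log-form `ht`/`htq`, units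
off `S` `ht1`/`htq1` — branch C's side conditions, inhabited at the genuine datum by `Cor312Prov.exists_realising_{q,theta}Ideles_pilotDataOfK`):
* §M3 `qRegion_subset_thetaHull_settingPrVolSharp_of_cellReachMixAt` — THE ANY-PRIME DOOR at the packet `(i+1, p)`: the mixed cells of the bad-last summands
  ⟹ the (xi-f) inclusion. PROOF = abc-iut-rp-d3's box-free multi-reach frame `RHLevelMover.qRegion_subset_thetaHull_settingPrVolSharp_of_multiReachFree`
  (p467833) summand by summand: GOOD last place ⟹ identity movers, unit weights; BAD last place ⟹ slot `a` carries `p^{k_a+1}·y_a` (`y_a` the conductor's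
  minimality witness, `RHLinearReachLawDoor` §0; levels `k_last = K`, `k_a = 0` else), moved by the level mover `RHLevelMover.exists_mover_of_not_mem_logUnits_fibre`
  (p461981) to norm `≥ p^{−k_a}·‖z_a‖` (`z_a` THE extremal log-unit); the two product inequalities are the two conjuncts of the cell through `‖ϖ_a‖ = p^{−1/e_a}`
  (`Thm311.Real.norm_unifOf`) and `EvalI06StarGenuine.norm_{q,theta}Idele_eq_rpow_of_realises` — NO «2l ∣ ord(q)». `…_of_hStarReachMix`: at every packet.
* §M4 `…_of_cellReachMixOn` — the def-free «S_H|Σ» shape on a packet stratum `σ` (label `0` / archimedean packets free, as in abc-iut-rh2-q2-hull's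
  `RH2SigmaHull` §1); `pilotKummerCompatHull_ofShells_settingPrVolSharp_of_hStarReachMix` — `HStarReachMix X` ⟹ the hSHw body VERBATIM (any columns, any `qK`).
* §M5 the same at print's `K`-level datum `Cor312Prov.pilotDataOfK D K`: `pilotKummerCompatHull_ofShells_pilotDataOfK_of_hStarReachMix` («datum in Σ₂₀^mix ⟹
  S_H-window verbatim», the input of «S|Σ₂₀ ⟹ abc» à la `RH2SigmaHullRow8/Row18`) and the Σ-local twin `qRegion_subset_thetaHull_pilotDataOfK_of_cellReachMixOn`.
  NO dictionary binder survives: uniformizers, THE lattice integers, their witnesses and the rational depth are read off the tree inside §M3.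
HONEST SCOPE: «the hull clause follows from the mixed cells AS TYPED», nothing more; OUR (Ind2) (Dupuy–Hilado, STRONGER-THAN-PRINT), SHARP boxes, (xi-f) at hull level.
[cite: Mochizuki2012, IUTchI Ex. 3.2 (iv) p. 71; IUTchIII Thm. 3.11 (i) (Ind2) p. 154, Cor. 3.12 Step (xi-f) p. 184; IUTchIV Prop. 1.4 (ii) p. 13]
[cite: NeukirchANT1999, Ch. II (5.5)] [cite: DupuyHilado2025, §3.9, §4.9] [cite: WeilBNT1967, Ch. II §2, Th. 1] [claim: Mochizuki2012, status: disputed]. 0 sorry.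
-/

noncomputable section

open Set Metric Function NumberField IsDedekindDomain
open scoped Pointwise

namespace Summit.ABC.IUTFork.Repair.RH.LinearReachLaw

open Literature.IUT.LogVolume Literature.NumberTheory.GaloisRepresentations.Ultrametric

/-! ## §M3. The door at ANY prime: the mixed cells of the bad-last summands ⟹ `qRegion (i+1) p ⊆ ⁿ˒°𝒰_{i+1,p}` (no `huniq`) -/

section Setting

open Thm311 Thm311.Real Cor312 Cor312.Setting Cor312Vol Cor312Prov Literature.IUT.LogThetaLattice Literature.IUT.HodgeTheaters
open Literature.NumberTheory.NumberFields Summit.ABC.IUTFork.Repair.RH.ShellCapacityPlus Summit.ABC.IUTFork.Repair.RHLevelMover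
variable {F : Type} [Field F] [NumberField F] (X : PilotData F) {logv : PadicLogs F} (hlog : LogvAnalytic logv)
  (M : Type) [Field M] [NumberField M]
  (archPk : ∀ (j : (thetaIndex X).Label) (vQ : (thetaIndex X).VQ), Set ((logShellsDH X logv).Packet j vQ))
  (archSub : ∀ (j : (thetaIndex X).Label) (v : (thetaIndex X).V),
    Set ((logShellsDH X logv).Packet j ((thetaIndex X).over v)))
  (Ψ : ℤ → ∀ v : (thetaIndex X).V, v ∈ (thetaIndex X).Vbad → Set ((logShellsDH X logv).StarPacket v))
  (act : ℤ → ∀ v : (thetaIndex X).V, v ∈ (thetaIndex X).Vbad →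
    (logShellsDH X logv).StarPacket v → Module.End ℚ ((logShellsDH X logv).StarPacket v))
  (Mmod : ℤ → ∀ j : (thetaIndex X).LabelStar, Set ((logShellsDH X logv).GlobalPacket j.1))
  (region : ℤ → ∀ j : (thetaIndex X).LabelStar, FinDivisor M → ∀ vQ : (thetaIndex X).VQ,
    Set ((logShellsDH X logv).Packet j.1 vQ))
  (n : ℤ) {HT : Type} {LogLink : HT → HT → Type} {IsFull : ∀ {s t : HT}, LogLink s t → Prop}
  (lat : LGPGaussianLogThetaLattice LogLink IsFull)
  {Frd : Type} {IsoF : Frd → Frd → Type} {Ob : Frd → Type} {realify : Frd → Frd} {Strip : Type}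
  {IsoS : Strip → Strip → Type} {Mv : ∀ v : (thetaIndex X).V, v ∈ (thetaIndex X).Vbad → Type}
  [∀ v h, Monoid (Mv v h)]
  (sig : GlobalLGPFrobenioidSignature (thetaIndex X).lstar (thetaIndex X).V (· ∈ (thetaIndex X).Vbad)
    Frd IsoF Ob realify Strip IsoS Mv)
  (split : SplittingMonoids Mv) {ObΔ : Type} {N : ∀ v : (thetaIndex X).V, v ∈ (thetaIndex X).Vbad → Type}
  [∀ v h, Monoid (N v h)] (qData : QPilotData ObΔ N)
  (tq : ∀ (pp : Nat.Primes) (x : (thetaIndex X).Fibre (.inr pp)), haveI : Fact (pp : ℕ).Prime := ⟨pp.2⟩; kOf X pp.1 x)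
  (t : ∀ (pp : Nat.Primes) (_ : Fin X.lstar) (x : (thetaIndex X).Fibre (.inr pp)),
    haveI : Fact (pp : ℕ).Prime := ⟨pp.2⟩; kOf X pp.1 x)
  (htq0 : ∀ pp x, tq pp x ≠ 0)
  (htq1 : ∀ (pp : Nat.Primes) (x : (thetaIndex X).Fibre (.inr pp)),
    haveI : Fact (pp : ℕ).Prime := ⟨pp.2⟩; placeOf X pp.1 x ∉ X.S → ‖tq pp x‖ = 1)
  (ht0 : ∀ pp i x, t pp i x ≠ 0)
  (ht1 : ∀ (pp : Nat.Primes) (i : Fin X.lstar) (x : (thetaIndex X).Fibre (.inr pp)),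
    haveI : Fact (pp : ℕ).Prime := ⟨pp.2⟩; placeOf X pp.1 x ∉ X.S → ‖t pp i x‖ = 1)
  -- the HONEST realising side conditions of the `K`-level certificates (`Cor312Prov.exists_realising_*`)
  (ht : ∀ (pp : Nat.Primes) (i : Fin X.lstar) (x : (thetaIndex X).Fibre (.inr pp)),
    haveI : Fact (pp : ℕ).Prime := ⟨pp.2⟩
    Real.log ‖t pp i x‖ = -(X.thetaPilot i (placeOf X pp.1 x)) * logNorm F (placeOf X pp.1 x) /
      localDegree F (placeOf X pp.1 x))
  (htq : ∀ (pp : Nat.Primes) (x : (thetaIndex X).Fibre (.inr pp)),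
    haveI : Fact (pp : ℕ).Prime := ⟨pp.2⟩
    Real.log ‖tq pp x‖ = -(X.qPilot (placeOf X pp.1 x)) * logNorm F (placeOf X pp.1 x) /
      localDegree F (placeOf X pp.1 x))

include ht0 ht1 ht htq in
/-- **THE ANY-PRIME DOOR.** At the packet `(i+1, p)` — ANY number of places over `p` — the mixed cells `CellReachMixAt X p i v⃗` of the summands `v⃗` whose
LAST slot sits at a bad place give `qRegion (i+1) p ⊆ thetaHull (i+1) p` at `settingPrVolSharp`, for ideles HONESTLY REALISING the pilot divisors (`ht`/`htq`)
and units off `S` (`ht1`/`htq1`). PROOF = abc-iut-rp-d3's frame `RHLevelMover.qRegion_subset_thetaHull_settingPrVolSharp_of_multiReachFree` (p467833) summand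
by summand (see the module docstring): good last place ⟹ identity movers, unit weights; bad last place ⟹ weights `p^{k_a+1}·y_a` (`k_last = K`, `k_a = 0` else)
and level movers (p461981); the product inequalities are the cell's two conjuncts through `‖ϖ_a‖ = p^{−1/e_a}` and the realising norms — NO «`2l ∣ ord(q)`».
[cite: Mochizuki2012, IUTchIII Cor. 3.12 Step (xi-f) p. 184; IUTchIV Prop. 1.4 (ii) p. 13] [cite: DupuyHilado2025, §3.9, §4.9] [cite: WeilBNT1967, Ch. II §2, Th. 1]
[cite: NeukirchANT1999, Ch. II (5.5)] [claim: Mochizuki2012, status: disputed] -/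
theorem qRegion_subset_thetaHull_settingPrVolSharp_of_cellReachMixAt (pp : Nat.Primes) (i : Fin X.lstar)
    (hcell : ∀ ev : (thetaIndex X).Caps (Setting.labelSucc i) → (thetaIndex X).Fibre (.inr pp),
      haveI : Fact (pp : ℕ).Prime := ⟨pp.2⟩; placeOf X pp.1 (ev (Fin.last _)) ∈ X.S → CellReachMixAt X pp i ev) :
    (settingPrVolSharp X hlog M archPk archSub Ψ act Mmod region n lat sig split qData tq t htq0 htq1).qRegion (Setting.labelSucc i)
        (.inr pp) ⊆
      (settingPrVolSharp X hlog M archPk archSub Ψ act Mmod region n lat sig split qData tq t htq0 htq1).thetaHull (Setting.labelSucc i)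
        (.inr pp) := by
  haveI hpF : Fact (pp : ℕ).Prime := ⟨pp.2⟩
  classical
  have hp0 : (0 : ℝ) < ((pp : ℕ) : ℝ) := by exact_mod_cast pp.2.pos
  have hp1 : (1 : ℝ) < ((pp : ℕ) : ℝ) := by exact_mod_cast pp.2.one_lt
  refine qRegion_subset_thetaHull_settingPrVolSharp_of_multiReachFree X hlog M archPk archSub Ψ act Mmod region n lat sig split qData tq
    t htq0 htq1 ht0 pp i fun ev => ?_
  by_cases hw : placeOf X pp.1 (ev (Fin.last _)) ∈ X.S
  swap
  · -- GOOD last place: identity movers, unit weights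
    refine ⟨fun _ _ => LinearEquiv.refl ℚ _, fun _ x => (logShellsDH X logv).one_mem_ism x.1, fun _ => 1, ?_, ?_⟩
    · rw [Finset.prod_eq_one fun a _ => norm_one, ht1 pp i _ hw]
    · rw [htq1 pp _ hw]
      refine (Finset.prod_eq_one fun a _ => ?_).symm.le
      rw [LinearEquiv.refl_apply, LinearEquiv.apply_symm_apply]
      exact (norm_one (α := kOf X pp.1 (ev a)))
  · -- BAD last place: the level weights of the mixed cell
    -- per-slot dictionary: norm uniformizers, THE lattice integers, the conductor witness below `c`, the extremal log-unit
    have hϖ : ∀ a, IsUniformizer (unifOf X pp.1 (ev a)) := fun a =>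
      (exists_isUniformizer_rescaledCompletion F pp.1 (placeOf X pp.1 (ev a)) (natCast_mem_placeOf X pp.1 (ev a))).choose_spec.1
    have hc' : ∀ a, ∃ c : ℕ, IsInnerConductor (kOf X pp.1 (ev a)) (unifOf X pp.1 (ev a)) c := fun a =>
      exists_isInnerConductor (pp : ℕ) (hϖ a)
    choose c hc using hc'
    have hB' : ∀ a, ∃ B : ℤ, IsOuterOrder (kOf X pp.1 (ev a)) (unifOf X pp.1 (ev a)) B := fun a =>
      exists_isOuterOrder (pp : ℕ) (hϖ a)
    choose B hB using hB'
    have hy' : ∀ a, ∃ y : kOf X pp.1 (ev a), y ∉ logUnits (kOf X pp.1 (ev a)) ∧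
        ‖y‖ ≤ ‖(unifOf X pp.1 (ev a) : kOf X pp.1 (ev a))‖ ^ ((c a : ℤ) - 1) := fun a =>
      exists_not_mem_logUnits_of_isInnerConductor (pp : ℕ) (hc a)
    choose y hy hyc using hy'
    have hz' : ∀ a, ∃ z ∈ logUnits (kOf X pp.1 (ev a)), ‖z‖ = ‖(unifOf X pp.1 (ev a) : kOf X pp.1 (ev a))‖ ^ (B a) := fun a => (hB a).2
    choose z hz hzB using hz'
    -- the mixed cell at THESE certificates
    obtain ⟨K, hK1, hK2⟩ := hcell ev hw (fun a => unifOf X pp.1 (ev a)) hϖ c B hc hB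
    -- real bookkeeping: ramification indices, `‖ϖ_a‖^m = p^{-m/e_a}`, the realising norms at the last place
    set e_ : (thetaIndex X).Caps (Setting.labelSucc i) → ℝ := fun a => ((placeOf X pp.1 (ev a)).asIdeal.ramificationIdx ℤ : ℝ) with he_
    have hϖzpow : ∀ a (m : ℤ), ‖(unifOf X pp.1 (ev a) : kOf X pp.1 (ev a))‖ ^ m = ((pp : ℕ) : ℝ) ^ (-(m : ℝ) / e_ a) := by
      intro a m
      rw [← Real.rpow_intCast, norm_unifOf X pp.1 (ev a), ← Real.rpow_mul hp0.le]
      congr 1; rw [he_]; ring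
    set μ : ℝ := (X.ordq (placeOf X pp.1 (ev (Fin.last _))) : ℝ) / (2 * X.l * e_ (Fin.last _)) with hμ
    have hq : ‖tq pp (ev (Fin.last _))‖ = ((pp : ℕ) : ℝ) ^ (-μ) :=
      EvalI06StarGenuine.norm_qIdele_eq_rpow_of_realises X tq htq0 htq pp _ hw
    have hΘ : ‖t pp i (ev (Fin.last _))‖ = ((pp : ℕ) : ℝ) ^ (-((((i : ℕ) : ℝ) + 1) ^ 2 * μ)) :=
      EvalI06StarGenuine.norm_thetaIdele_eq_rpow_of_realises X t ht tq htq0 htq pp i _ hw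
    -- the two conjuncts of the cell, over `ℝ`
    have hK1' : (((i : ℕ) : ℝ) + 1) ^ 2 * μ ≤ (K : ℝ) + ∑ a, (1 + ((c a : ℝ) - 1) / e_ a) := by
      have h := (Rat.cast_le (K := ℝ)).2 hK1
      push_cast at h
      rw [hμ, he_]
      exact h
    have hK2' : (K : ℝ) + ∑ a, (B a : ℝ) / e_ a ≤ μ := by
      have h := (Rat.cast_le (K := ℝ)).2 hK2
      push_cast at h
      rw [hμ, he_]
      exact h
    -- the levels: `K` on the last slot, `0` elsewhere
    let k : (thetaIndex X).Caps (Setting.labelSucc i) → ℤ := fun a => if a = Fin.last _ then K else 0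
    have hk : ∑ a, (k a : ℝ) = K := by
      have : ∀ a, (k a : ℝ) = if a = Fin.last _ then (K : ℝ) else 0 := fun a => by
        simp only [k]; split_ifs <;> simp
      simp_rw [this]
      rw [Finset.sum_ite_eq']
      simp
    -- the weights `p^{k_a+1} • y_a` and their level movers
    have hsu : ∀ a : (thetaIndex X).Caps (Setting.labelSucc i),
        (((pp : ℕ) : ℚ_[pp]) ^ (-(k a) - 1)) • ((((pp : ℕ) : ℚ_[pp]) ^ (k a + 1)) • y a) = y a := by
      intro a
      rw [smul_smul, ← zpow_add₀ (Nat.cast_ne_zero.2 pp.2.ne_zero), show -(k a) - 1 + (k a + 1) = 0 by ring, zpow_zero,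
        one_smul]
    have hmov : ∀ a : (thetaIndex X).Caps (Setting.labelSucc i), ∃ g ∈ (logShellsDH X logv).ism (ev a).1,
        ((pp : ℕ) : ℝ) ^ (-(k a)) * ‖z a‖ ≤
          ‖(presAt X hlog pp).φ (ev a) (g (((presAt X hlog pp).φ (ev a)).symm ((((pp : ℕ) : ℚ_[pp]) ^ (k a + 1)) • y a)))‖ :=
      fun a => exists_mover_of_not_mem_logUnits_fibre X hlog pp (ev a) (hsu a) (hy a) (hz a)
    choose g hg hreach using hmov
    refine ⟨fun a x => if h : x = ev a then h ▸ g a else LinearEquiv.refl ℚ _, fun a x => ?_,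
      fun a => (((pp : ℕ) : ℚ_[pp]) ^ (k a + 1)) • y a, ?_, ?_⟩
    · -- movers in `Ism`
      dsimp only
      split_ifs with h
      · subst h; exact hg a
      · exact (logShellsDH X logv).one_mem_ism x.1
    · -- (I) the product of the weights fits the Θ-box: `Π_a p^{-(k_a+1)}‖y_a‖ ≤ p^{-(K + Σ_a (1 + α_a))} ≤ p^{-(i+1)²μ} = ‖t_Θ‖`
      have hterm : ∀ a, ‖(((pp : ℕ) : ℚ_[pp]) ^ (k a + 1)) • y a‖ ≤
          ((pp : ℕ) : ℝ) ^ (-((k a : ℝ) + 1 + ((c a : ℝ) - 1) / e_ a)) := by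
        intro a
        have h1 : ‖y a‖ ≤ ((pp : ℕ) : ℝ) ^ (-((c a : ℝ) - 1) / e_ a) := by
          refine (hyc a).trans_eq ?_
          rw [hϖzpow]; push_cast; ring_nf
        have h2 : ((pp : ℕ) : ℝ) ^ (-(k a + 1)) = ((pp : ℕ) : ℝ) ^ (-((k a : ℝ) + 1)) := by
          rw [← Real.rpow_intCast]; push_cast; ring_nf
        rw [norm_zpow_prime_smul, h2, show -((k a : ℝ) + 1 + ((c a : ℝ) - 1) / e_ a) = -((k a : ℝ) + 1) + -((c a : ℝ) - 1) / e_ a by ring,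
          Real.rpow_add hp0]
        exact mul_le_mul_of_nonneg_left h1 (Real.rpow_nonneg hp0.le _)
      have hsplit : ∑ a, ((k a : ℝ) + 1 + ((c a : ℝ) - 1) / e_ a) = (K : ℝ) + ∑ a, (1 + ((c a : ℝ) - 1) / e_ a) := by
        rw [← hk, ← Finset.sum_add_distrib]
        exact Finset.sum_congr rfl fun a _ => by ring
      calc ∏ a, ‖(((pp : ℕ) : ℚ_[pp]) ^ (k a + 1)) • y a‖
          ≤ ∏ a, ((pp : ℕ) : ℝ) ^ (-((k a : ℝ) + 1 + ((c a : ℝ) - 1) / e_ a)) :=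
            Finset.prod_le_prod (fun a _ => norm_nonneg _) fun a _ => hterm a
        _ = ((pp : ℕ) : ℝ) ^ (∑ a, -((k a : ℝ) + 1 + ((c a : ℝ) - 1) / e_ a)) := (Real.rpow_sum_of_pos hp0 _ _).symm
        _ ≤ ((pp : ℕ) : ℝ) ^ (-((((i : ℕ) : ℝ) + 1) ^ 2 * μ)) := by
            refine Real.rpow_le_rpow_of_exponent_le hp1.le ?_
            rw [Finset.sum_neg_distrib, hsplit]
            linarith [hK1']
        _ = ‖t pp i (ev (Fin.last _))‖ := hΘ.symm
    · -- (II) the reached product dominates `t_q`: `‖t_q‖ = p^{-μ} ≤ p^{-(K + Σ_a β_a)} = Π_a p^{-k_a}‖z_a‖ ≤ Π_a ‖g_a(p^{k_a+1} y_a)‖`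
      have hterm : ∀ a, ((pp : ℕ) : ℝ) ^ (-((k a : ℝ) + (B a : ℝ) / e_ a)) = ((pp : ℕ) : ℝ) ^ (-(k a)) * ‖z a‖ := by
        intro a
        have h2 : ((pp : ℕ) : ℝ) ^ (-(k a)) = ((pp : ℕ) : ℝ) ^ (-(k a : ℝ)) := by
          rw [← Real.rpow_intCast]; push_cast; ring_nf
        rw [hzB, hϖzpow, h2, show -((k a : ℝ) + (B a : ℝ) / e_ a) = -(k a : ℝ) + -((B a : ℤ) : ℝ) / e_ a by ring,
          Real.rpow_add hp0]
      have hsplit : ∑ a, ((k a : ℝ) + (B a : ℝ) / e_ a) = (K : ℝ) + ∑ a, (B a : ℝ) / e_ a := by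
        rw [Finset.sum_add_distrib, hk]
      have hga : ∀ a, (if h : ev a = ev a then h ▸ g a else LinearEquiv.refl ℚ _) = g a := fun a => by rw [dif_pos rfl]
      calc ‖tq pp (ev (Fin.last _))‖ = ((pp : ℕ) : ℝ) ^ (-μ) := hq
        _ ≤ ((pp : ℕ) : ℝ) ^ (∑ a, -((k a : ℝ) + (B a : ℝ) / e_ a)) := by
            refine Real.rpow_le_rpow_of_exponent_le hp1.le ?_
            rw [Finset.sum_neg_distrib, hsplit]
            linarith [hK2']
        _ = ∏ a, ((pp : ℕ) : ℝ) ^ (-((k a : ℝ) + (B a : ℝ) / e_ a)) := Real.rpow_sum_of_pos hp0 _ _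
        _ = ∏ a, ((pp : ℕ) : ℝ) ^ (-(k a)) * ‖z a‖ := Finset.prod_congr rfl fun a _ => hterm a
        _ ≤ ∏ a, ‖(presAt X hlog pp).φ (ev a) ((if h : ev a = ev a then h ▸ g a else LinearEquiv.refl ℚ _)
              (((presAt X hlog pp).φ (ev a)).symm ((((pp : ℕ) : ℚ_[pp]) ^ (k a + 1)) • y a)))‖ :=
            Finset.prod_le_prod (fun a _ => by positivity) fun a _ => by rw [hga]; exact hreach a

include ht0 ht1 ht htq in
/-- **`HStarReachMix X` ⟹ the inclusion at EVERY packet `(i+1, p)`, EVERY prime** (realising ideles, units off `S`). [claim: Mochizuki2012, status: disputed] -/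
theorem qRegion_subset_thetaHull_settingPrVolSharp_of_hStarReachMix (hH : HStarReachMix X) (pp : Nat.Primes) (i : Fin X.lstar) :
    (settingPrVolSharp X hlog M archPk archSub Ψ act Mmod region n lat sig split qData tq t htq0 htq1).qRegion (Setting.labelSucc i)
        (.inr pp) ⊆
      (settingPrVolSharp X hlog M archPk archSub Ψ act Mmod region n lat sig split qData tq t htq0 htq1).thetaHull (Setting.labelSucc i)
        (.inr pp) :=
  qRegion_subset_thetaHull_settingPrVolSharp_of_cellReachMixAt X hlog M archPk archSub Ψ act Mmod region n lat sig split qData tq t htq0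
    htq1 ht0 ht1 ht htq pp i fun ev hw => hH pp i ev hw

/-! ## §M4. «S_H|Σ» and the hSHw body from the mixed cells (any pilot datum) -/
include ht0 ht1 ht htq in
/-- **«S_H ON A PACKET STRATUM» from the mixed cells ON THAT STRATUM (any pilot datum, any primes).** `σ p i` = the stratum `Σ` of packets `(i+1, p)`;
the mixed cells on the bad-last summands of the packets of `Σ` (`hHσ`) give `qRegion j v_ℚ ⊆ ⁿ˒°𝒰_{j,v_ℚ}` at every packet all of whose presentations
`(i+1, p)` lie in `Σ` — on `Σ` by §M3, at the label `0` by identity movers (`exists_mover_of_norm_le`; integral `t_q`, `norm_qIdele_le_one_of_realises`), at the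
archimedean packets by `qRegion_subset_thetaHull_settingDHVolSharp_inl` (the def-free «S_H|Σ» shape of `RH2SigmaHull` §1, for THIS family).
[cite: DupuyHilado2025, §3.9, §4.9] [claim: Mochizuki2012, status: disputed] -/
theorem qRegion_subset_thetaHull_settingPrVolSharp_of_cellReachMixOn (σ : Nat.Primes → Fin (thetaIndex X).lstar → Prop)
    (hHσ : ∀ (pp : Nat.Primes) (i : Fin (thetaIndex X).lstar), σ pp i →
      ∀ ev : (thetaIndex X).Caps (Setting.labelSucc i) → (thetaIndex X).Fibre (.inr pp),
        haveI : Fact (pp : ℕ).Prime := ⟨pp.2⟩; placeOf X pp.1 (ev (Fin.last _)) ∈ X.S → CellReachMixAt X pp i ev)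
    (j : (thetaIndex X).Label) (vQ : (thetaIndex X).VQ)
    (hjv : ∀ (pp : Nat.Primes) (i : Fin (thetaIndex X).lstar), vQ = .inr pp → j = Setting.labelSucc i → σ pp i) :
    (settingPrVolSharp X hlog M archPk archSub Ψ act Mmod region n lat sig split qData tq t htq0 htq1).qRegion j vQ ⊆
      (settingPrVolSharp X hlog M archPk archSub Ψ act Mmod region n lat sig split qData tq t htq0 htq1).thetaHull j vQ := by
  haveI hne : ∀ pp : Nat.Primes, Fact (pp : ℕ).Prime := fun pp => ⟨pp.2⟩
  by_cases hj : 0 < (j : ℕ)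
  · -- a label of `𝔽_l^⋇`
    have hj' : j = labelSucc ⟨(j : ℕ) - 1, by have := j.2; simp only [thetaIndex] at this ⊢; omega⟩ := by
      ext; simp only [labelSucc, Fin.val_succ]; omega
    cases vQ with
    | inl u =>
      rw [hj']
      exact qRegion_subset_thetaHull_settingDHVolSharp_inl X hlog M archPk archSub Ψ act Mmod region n lat sig split qData tq t htq0
        htq1 (labelSucc _) u
    | inr pp =>
      have hσ : σ pp ⟨(j : ℕ) - 1, by have := j.2; simp only [thetaIndex] at this ⊢; omega⟩ := hjv pp _ rfl hj'
      rw [hj']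
      exact qRegion_subset_thetaHull_settingPrVolSharp_of_cellReachMixAt X hlog M archPk archSub Ψ act Mmod region n lat sig split qData
        tq t htq0 htq1 ht0 ht1 ht htq pp _ (hHσ pp _ hσ)
  · -- the label `0`: the Θ-idele is `1`, identity movers for integral `t_q`
    refine qRegion_subset_thetaHull_settingDHVolSharp_of_movers X hlog M archPk archSub Ψ act Mmod region n lat sig split qData tq t
      htq0 htq1 j vQ fun pp x => exists_mover_of_norm_le X hlog tq t pp j x ?_
    unfold labelIdele
    rw [dif_neg hj, norm_one]
    exact norm_qIdele_le_one_of_realises X tq htq0 htq pp x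

include ht0 ht1 ht htq in
/-- **H⋆₂₀-MIX ⟹ THE hSHw BODY VERBATIM** (any pilot datum `X`, realising ideles; ANY columns, ANY `qK`): the binder `hSHw` of
`Conditional.abc_of_SH_v10K_window` at this setting, from the mixed cells at EVERY prime (§M4 at `Σ = ⊤`). A HYPOTHESIS ⟹ a clause; no side taken.
[cite: Mochizuki2012, IUTchIII Cor. 3.12 Step (xi-f) p. 184] [claim: Mochizuki2012, status: disputed] -/
theorem pilotKummerCompatHull_ofShells_settingPrVolSharp_of_hStarReachMix
    (frobAdm : ℤ → ℤ → ∀ (j : (thetaIndex X).Label) (vQ : (thetaIndex X).VQ), Set ((logShellsDH X logv).Packet j vQ) → Prop)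
    (frobLogvol : ℤ → ℤ → ∀ (j : (thetaIndex X).Label) (vQ : (thetaIndex X).VQ), Set ((logShellsDH X logv).Packet j vQ) → ℝ)
    (frobΨ : ℤ → ℤ → ∀ v : (thetaIndex X).V, v ∈ (thetaIndex X).Vbad → Set ((logShellsDH X logv).StarPacket v))
    (frobMmod : ℤ → ℤ → ∀ j : (thetaIndex X).LabelStar, Set ((logShellsDH X logv).GlobalPacket j.1))
    (unitImage : ℤ → ℤ → ℕ → ∀ (j : (thetaIndex X).Label) (vQ : (thetaIndex X).VQ), Set ((logShellsDH X logv).Packet j vQ))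
    (ballImage : ℤ → ℤ → ∀ (j : (thetaIndex X).Label) (vQ : (thetaIndex X).VQ), Set ((logShellsDH X logv).Packet j vQ))
    (thetaDiv : ℤ → ℤ → LgpDivisor M (thetaIndex X).lstar)
    (qK : ∀ v : (thetaIndex X).V, v ∈ (thetaIndex X).Vbad → Set ((logShellsDH X logv).StarPacket v)) (hH : HStarReachMix X) :
    PilotKummerCompatHull
      (LatticeSituation.ofShells (logShellsDH X logv) M archPk archSub (summandPiecesPr X hlog).Adm (summandPiecesPr X hlog).logvol
        Ψ act Mmod region frobAdm frobLogvol frobΨ frobMmod unitImage ballImage thetaDiv)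
      (settingPrVolSharp X hlog M archPk archSub Ψ act Mmod region n lat sig split qData tq t htq0 htq1)
      (fun _ => (settingPrVolSharp X hlog M archPk archSub Ψ act Mmod region n lat sig split qData tq t htq0 htq1).qRegion) qK :=
  fun j vQ =>
    qRegion_subset_thetaHull_settingPrVolSharp_of_cellReachMixOn X hlog M archPk archSub Ψ act Mmod region n lat sig split qData tq t htq0
      htq1 ht0 ht1 ht htq (fun _ _ => True) (fun pp i _ ev hw => hH pp i ev hw) j vQ fun _ _ _ _ => trivial

end Setting

/-! ## §M5. At print's own `K`-level pilot datum `Cor312Prov.pilotDataOfK D K` (the genuine bed of abc-iut-rh2-q2-hull's `RH2SigmaHull*`) -/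

section Genuine
open Thm311 Thm311.Real Cor312 Cor312.Setting Cor312Vol Cor312Prov Literature.IUT.LogThetaLattice Literature.IUT.HodgeTheaters
open Literature.NumberTheory.NumberFields

variable {F K Fbar : Type} [Field F] [NumberField F] [Field K] [NumberField K] [Algebra F K] [Field Fbar]
  [Algebra F Fbar] [Algebra K Fbar] {E : WeierstrassCurve F} [E.IsElliptic] {l : ℕ} {Pb : BadPlacePredicates K}
  (D : InitialThetaData F K Fbar E l Pb) {logv : PadicLogs K} (hlog : LogvAnalytic logv) (M : Type) [Field M] [NumberField M]
  (archPk : ∀ (j : (thetaIndex (pilotDataOfK D K)).Label) (vQ : (thetaIndex (pilotDataOfK D K)).VQ),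
    Set ((logShellsDH (pilotDataOfK D K) logv).Packet j vQ))
  (archSub : ∀ (j : (thetaIndex (pilotDataOfK D K)).Label) (v : (thetaIndex (pilotDataOfK D K)).V),
    Set ((logShellsDH (pilotDataOfK D K) logv).Packet j ((thetaIndex (pilotDataOfK D K)).over v)))
  (Ψ : ℤ → ∀ v : (thetaIndex (pilotDataOfK D K)).V, v ∈ (thetaIndex (pilotDataOfK D K)).Vbad →
    Set ((logShellsDH (pilotDataOfK D K) logv).StarPacket v))
  (act : ℤ → ∀ v : (thetaIndex (pilotDataOfK D K)).V, v ∈ (thetaIndex (pilotDataOfK D K)).Vbad →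
    (logShellsDH (pilotDataOfK D K) logv).StarPacket v → Module.End ℚ ((logShellsDH (pilotDataOfK D K) logv).StarPacket v))
  (Mmod : ℤ → ∀ j : (thetaIndex (pilotDataOfK D K)).LabelStar, Set ((logShellsDH (pilotDataOfK D K) logv).GlobalPacket j.1))
  (region : ℤ → ∀ j : (thetaIndex (pilotDataOfK D K)).LabelStar, FinDivisor M → ∀ vQ : (thetaIndex (pilotDataOfK D K)).VQ,
    Set ((logShellsDH (pilotDataOfK D K) logv).Packet j.1 vQ))
  (frobAdm : ℤ → ℤ → ∀ (j : (thetaIndex (pilotDataOfK D K)).Label) (vQ : (thetaIndex (pilotDataOfK D K)).VQ),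
    Set ((logShellsDH (pilotDataOfK D K) logv).Packet j vQ) → Prop)
  (frobLogvol : ℤ → ℤ → ∀ (j : (thetaIndex (pilotDataOfK D K)).Label) (vQ : (thetaIndex (pilotDataOfK D K)).VQ),
    Set ((logShellsDH (pilotDataOfK D K) logv).Packet j vQ) → ℝ)
  (frobΨ : ℤ → ℤ → ∀ v : (thetaIndex (pilotDataOfK D K)).V, v ∈ (thetaIndex (pilotDataOfK D K)).Vbad →
    Set ((logShellsDH (pilotDataOfK D K) logv).StarPacket v))
  (frobMmod : ℤ → ℤ → ∀ j : (thetaIndex (pilotDataOfK D K)).LabelStar, Set ((logShellsDH (pilotDataOfK D K) logv).GlobalPacket j.1))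
  (unitImage : ℤ → ℤ → ℕ → ∀ (j : (thetaIndex (pilotDataOfK D K)).Label) (vQ : (thetaIndex (pilotDataOfK D K)).VQ),
    Set ((logShellsDH (pilotDataOfK D K) logv).Packet j vQ))
  (ballImage : ℤ → ℤ → ∀ (j : (thetaIndex (pilotDataOfK D K)).Label) (vQ : (thetaIndex (pilotDataOfK D K)).VQ),
    Set ((logShellsDH (pilotDataOfK D K) logv).Packet j vQ))
  (thetaDiv : ℤ → ℤ → LgpDivisor M (thetaIndex (pilotDataOfK D K)).lstar)
  (n : ℤ) {HT : Type} {LogLink : HT → HT → Type} {IsFull : ∀ {s t : HT}, LogLink s t → Prop}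
  (lat : LGPGaussianLogThetaLattice LogLink IsFull)
  {Frd : Type} {IsoF : Frd → Frd → Type} {Ob : Frd → Type} {realify : Frd → Frd} {Strip : Type} {IsoS : Strip → Strip → Type}
  {Mv : ∀ v : (thetaIndex (pilotDataOfK D K)).V, v ∈ (thetaIndex (pilotDataOfK D K)).Vbad → Type} [∀ v h, Monoid (Mv v h)]
  (sig : GlobalLGPFrobenioidSignature (thetaIndex (pilotDataOfK D K)).lstar (thetaIndex (pilotDataOfK D K)).V
    (· ∈ (thetaIndex (pilotDataOfK D K)).Vbad) Frd IsoF Ob realify Strip IsoS Mv)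
  (split : SplittingMonoids Mv) {ObΔ : Type}
  {N : ∀ v : (thetaIndex (pilotDataOfK D K)).V, v ∈ (thetaIndex (pilotDataOfK D K)).Vbad → Type} [∀ v h, Monoid (N v h)]
  (qData : QPilotData ObΔ N)
  (qK : ∀ v : (thetaIndex (pilotDataOfK D K)).V, v ∈ (thetaIndex (pilotDataOfK D K)).Vbad →
    Set ((logShellsDH (pilotDataOfK D K) logv).StarPacket v))
  (tq : ∀ (pp : Nat.Primes) (x : (thetaIndex (pilotDataOfK D K)).Fibre (.inr pp)),
    haveI : Fact (pp : ℕ).Prime := ⟨pp.2⟩; kOf (pilotDataOfK D K) pp.1 x)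
  (t : ∀ (pp : Nat.Primes) (_ : Fin (pilotDataOfK D K).lstar) (x : (thetaIndex (pilotDataOfK D K)).Fibre (.inr pp)),
    haveI : Fact (pp : ℕ).Prime := ⟨pp.2⟩; kOf (pilotDataOfK D K) pp.1 x)
  (htq0 : ∀ pp x, tq pp x ≠ 0)
  (htq1 : ∀ (pp : Nat.Primes) (x : (thetaIndex (pilotDataOfK D K)).Fibre (.inr pp)),
    haveI : Fact (pp : ℕ).Prime := ⟨pp.2⟩; placeOf (pilotDataOfK D K) pp.1 x ∉ (pilotDataOfK D K).S → ‖tq pp x‖ = 1)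
  (ht0 : ∀ pp i x, t pp i x ≠ 0)
  (ht1 : ∀ (pp : Nat.Primes) (i : Fin (pilotDataOfK D K).lstar) (x : (thetaIndex (pilotDataOfK D K)).Fibre (.inr pp)),
    haveI : Fact (pp : ℕ).Prime := ⟨pp.2⟩; placeOf (pilotDataOfK D K) pp.1 x ∉ (pilotDataOfK D K).S → ‖t pp i x‖ = 1)
  (ht : ∀ (pp : Nat.Primes) (i : Fin (pilotDataOfK D K).lstar) (x : (thetaIndex (pilotDataOfK D K)).Fibre (.inr pp)),
    haveI : Fact (pp : ℕ).Prime := ⟨pp.2⟩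
    Real.log ‖t pp i x‖ = -((pilotDataOfK D K).thetaPilot i (placeOf (pilotDataOfK D K) pp.1 x)) *
      logNorm K (placeOf (pilotDataOfK D K) pp.1 x) / localDegree K (placeOf (pilotDataOfK D K) pp.1 x))
  (htq : ∀ (pp : Nat.Primes) (x : (thetaIndex (pilotDataOfK D K)).Fibre (.inr pp)),
    haveI : Fact (pp : ℕ).Prime := ⟨pp.2⟩
    Real.log ‖tq pp x‖ = -((pilotDataOfK D K).qPilot (placeOf (pilotDataOfK D K) pp.1 x)) *
      logNorm K (placeOf (pilotDataOfK D K) pp.1 x) / localDegree K (placeOf (pilotDataOfK D K) pp.1 x))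

include ht0 ht1 ht htq in
/-- **«DATUM IN Σ₂₀^mix ⟹ S_H-WINDOW VERBATIM» at the GENUINE BED with REALISING ideles**: H⋆₂₀-MIX at `Cor312Prov.pilotDataOfK D K` ([IUTchI] Ex. 3.2 (iv))
⟹ `PilotKummerCompatHull (LatticeSituation.ofShells …) (settingPrVolSharp (pilotDataOfK D K) … tq t …) (fun _ => qRegion) qK` — the BODY of the binder `hSHw` of
`Conditional.abc_of_SH_v10K_window` at this datum (ANY columns, ANY `qK`), NO dictionary binder left; row 20's datum-strata input for «S|Σ₂₀ ⟹ abc» in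
abc-iut-rh2-q2-hull's currency (`RH2SigmaHullRow8/Row18`). The candidate is a HYPOTHESIS; no side taken. [cite: Mochizuki2012, IUTchI Ex. 3.2 (iv) p. 71;
IUTchIII Cor. 3.12 Step (xi-f) p. 184] [cite: DupuyHilado2025, §3.9, §4.9] [claim: Mochizuki2012, status: disputed] -/
theorem pilotKummerCompatHull_ofShells_pilotDataOfK_of_hStarReachMix (hH : HStarReachMix (pilotDataOfK D K)) :
    PilotKummerCompatHull
      (LatticeSituation.ofShells (logShellsDH (pilotDataOfK D K) logv) M archPk archSub (summandPiecesPr (pilotDataOfK D K) hlog).Adm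
        (summandPiecesPr (pilotDataOfK D K) hlog).logvol Ψ act Mmod region frobAdm frobLogvol frobΨ frobMmod unitImage ballImage thetaDiv)
      (settingPrVolSharp (pilotDataOfK D K) hlog M archPk archSub Ψ act Mmod region n lat sig split qData tq t htq0 htq1)
      (fun _ => (settingPrVolSharp (pilotDataOfK D K) hlog M archPk archSub Ψ act Mmod region n lat sig split qData tq t htq0 htq1).qRegion)
      qK :=
  pilotKummerCompatHull_ofShells_settingPrVolSharp_of_hStarReachMix (pilotDataOfK D K) hlog M archPk archSub Ψ act Mmod region n lat sig split
    qData tq t htq0 htq1 ht0 ht1 ht htq frobAdm frobLogvol frobΨ frobMmod unitImage ballImage thetaDiv qK hH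

include ht0 ht1 ht htq in
/-- **«S_H ON Σ» at the GENUINE BED** (Σ-local twin, CELL/PACKET-strata currency): the mixed cells of the genuine datum on a packet stratum `σ` give the
(xi-f) inclusion at every packet of `Σ̂ = Σ ∪ {j = 0} ∪ {v_ℚ = ∞}` (the `S_H|Σ` input of the weakened-Cor-3.12 target, abc-iut-rh2-q2-eq / rh2-q2-cond).
[cite: DupuyHilado2025, §3.9, §4.9] [claim: Mochizuki2012, status: disputed] -/
theorem qRegion_subset_thetaHull_pilotDataOfK_of_cellReachMixOn
    (σ : Nat.Primes → Fin (thetaIndex (pilotDataOfK D K)).lstar → Prop)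
    (hHσ : ∀ (pp : Nat.Primes) (i : Fin (thetaIndex (pilotDataOfK D K)).lstar), σ pp i →
      ∀ ev : (thetaIndex (pilotDataOfK D K)).Caps (Setting.labelSucc i) → (thetaIndex (pilotDataOfK D K)).Fibre (.inr pp),
        haveI : Fact (pp : ℕ).Prime := ⟨pp.2⟩;
        placeOf (pilotDataOfK D K) pp.1 (ev (Fin.last _)) ∈ (pilotDataOfK D K).S → CellReachMixAt (pilotDataOfK D K) pp i ev)
    (j : (thetaIndex (pilotDataOfK D K)).Label) (vQ : (thetaIndex (pilotDataOfK D K)).VQ)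
    (hjv : ∀ (pp : Nat.Primes) (i : Fin (thetaIndex (pilotDataOfK D K)).lstar), vQ = .inr pp → j = Setting.labelSucc i → σ pp i) :
    (settingPrVolSharp (pilotDataOfK D K) hlog M archPk archSub Ψ act Mmod region n lat sig split qData tq t htq0 htq1).qRegion j vQ ⊆
      (settingPrVolSharp (pilotDataOfK D K) hlog M archPk archSub Ψ act Mmod region n lat sig split qData tq t htq0 htq1).thetaHull j vQ :=
  qRegion_subset_thetaHull_settingPrVolSharp_of_cellReachMixOn (pilotDataOfK D K) hlog M archPk archSub Ψ act Mmod region n lat sig split qData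
    tq t htq0 htq1 ht0 ht1 ht htq σ hHσ j vQ hjv

end Genuine

end Summit.ABC.IUTFork.Repair.RH.LinearReachLaw

end
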